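import Literature.NumberTheory.GelbartRogawski1991.LocalDoubledSiegelUnipotentAnisotropy
import Literature.NumberTheory.GelbartRogawski1991.LocalDoubledTwistedSectionEigenlaw
import Literature.NumberTheory.GelbartRogawski1991.LocalDoubledSiegelParabolicModularCharacter
import Literature.NumberTheory.GelbartRogawski1991.LocalSchrodingerWeylFourierTwin
import Literature.NumberTheory.GelbartRogawski1991.CMSplittingCharLocalMu
import Literature.NumberTheory.GelbartRogawski1991.LocalDoubledInvariantFunctional
import Literature.NumberTheory.GelbartRogawski1991.LocalDoubledSiegelUnipotentDetOne
import HarnessLib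

-- buildfix G11b-3 recipe (LEDGER B13-1/B13-3), as in the GelbartRogawski1991 siblings: elaborate sequentially.
set_option Elab.async false

/-!
# (BR-N) THE UNIPOTENT WORD of the soft road's twisted section — EXACT, NO SCALAR:
# `s′(n(bτ)) = Γ⁻¹ ∘ unipOpPi (b • c_τ) ∘ Γ` at the Siegel unipotents of the standard doubled line

[Kudla1994] §3 Thm. 3.1 (the splitting of the doubled unitary group is a character-twist of the Leray∕Rao cocycle section; on the Siegel
unipotent radical it is the Schrödinger-model multiplication operator); [MoeglinVignerasWaldspurger1987] Chap. 2 II.1 (A)–(B), II.6 (implementers are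
unique up to scalars; the `Δ`-functional `Φ ↦ Φ(0)`; unipotent operators); [Rangarao1993] Lemma 3.2 (3.8), p. 351 and Thm. 3.5 (`r(n(c)) Φ = ψ(½⟨x, cx⟩) Φ`);
[HarrisKudlaSweet1996] §1 (1.15) (the eigen-law of the Siegel parabolic).  Topic `NumberTheory/GelbartRogawski1991`; namespace
`Literature.NumberTheory.GelbartRogawski1991.UnitaryDualPair.LocalSplitting` (sibling of ★ `LocalDoubledTwistedSectionWeylWord` — SAME CM binder telescope —,
of ★ `LocalDoubledTwistedSectionEigenlaw` §4, ★ `LocalDoubledSiegelUnipotentMover`, ★ `LocalDoubledSiegelUnipotentDetOne`).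
KERNEL ONLY: theorems; no definition, no instance, no notation, no named fact, no `sorry`.

THE STATEMENT.  `L` CM (`c̄ = IsCMField.complexConj L`, `δ = imagUnit L`), `v` a finite place of `L⁺`, Haar `μ` on `L⁺_v`, a real symmetric non-degenerate
`T ∈ M_{1+1}(L⁺)`, a splitting Hecke character `χ`, the standard doubled line `G₁ = U(⟨1⟩ ⊕ ⟨−1⟩)(L⁺_v) = localPi L c̄ (1+1) JD₁ v`, its Siegel unipotents
`n(t) := nElem L⁺ L c̄ v 1 hJD₁ (t • 1) _` (`t ∈ L ⊗ L⁺_v` skew: `c̄ t = −t`, ★ `skew_smul_one`), and the soft road's TWISTED SECTION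
`s′(h) = μ_v(det h)⁻¹ • ω^𝔻(s^𝔻(ι h))` (`ι = kronLoc … 2`, `s^𝔻 = (localSplittingDatumCM L v μ 2 hTs hTd rfl χ hχ).localSplitting`, `ω^𝔻 = MpPsi.toRep` of the
Schrödinger model `ρ_𝕋` of `gramD L⁺ 2 T ⊗ L⁺_v` — the letters of ★ `apply_zero_toRep_twistedSection_kronLoc_eq_modularCharacter_mul` and of the (OPW) junction
★ `Theorems/F0LD2ZVanOfOperatorWords`).  For a mover `E″ ∈ Sp(𝕎^𝔻_v)` with `E″ ℓ_Δ = ℓ_Y` and ANY implementer `Γ` of `E″` on `𝒮(L⁺_v^{2+2})`, put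
`c_τ := cOfFix 𝕋 (E″ · ι_D(n₂(τ·1)) · E″⁻¹)` (★ `cOfFix`, `n₂ = nElem … 2`, the Rao parameter of the conjugated unipotent, ★ `LocalDoubledSiegelUnipotentMover`).

* §1 (generic `E∕F`, any `n`, any implementer section `r` with implementers unique up to scalars)
  **`exists_section_iotaD_nElem_apply_eq_smul_conj_unipOpPi`** — `∃ γ : ℂˣ, ∀ Φ, r(ι_D(n(t))) Φ = γ • Γ⁻¹ (unipOpPi (c ·) (Γ Φ))`: `E′ ι_D(n(t)) E′⁻¹ = low c`
  (★ `mover_conj_iotaD_nElem_eq_transportSp_low`), `unipOpPi c` implements `low c` (★ `implements_transportSp_low_unipOpPi`), conjugation principle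
  ★ `exists_smul_eq_conj_of_implements_conj`.
* §2 (CM, the standard doubled line) **`exists_twistedSection_kronLoc_nElem_apply_eq_smul_conj_unipOpPi`** — `∃ γ : ℂ, ∀ Ψ, s′(n(τ)) Ψ = γ • Γ⁻¹ (unipOpPi c_τ (Γ Ψ))`
  (`ι(n₁(τ·1)) = n₂(τ·1)` ★ `kronLoc_nElem`; `μ_v(det n) = 1` ★ `localMu_det_localPiEquiv_nElem`; `ω^𝔻 ∘ s^𝔻 = β⁻¹ • r ∘ ι_D` ★ `localOmega_apply`; §1).
* **`twistedSection_kronLoc_nElem_apply_eq_conj_unipOpPi`** — THE EXACT WORD `s′(n(τ)) Ψ = Γ⁻¹ (unipOpPi c_τ (Γ Ψ))`: the scalar `γ` is `1` because the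
  `Δ`-functional `λ′ : Φ ↦ (Γ Φ)(0)` is an eigenfunctional of `s′` on the Siegel parabolic with eigencharacter `Δ_{P_Δ}` (★ eigen-law
  `apply_zero_toRep_twistedSection_kronLoc_eq_modularCharacter_mul` at the implementer `m₀ = (E″, Γ)`), `Δ_{P_Δ}(n(τ)) = 1` (★ `modularCharacter_nElem_eq_one`),
  `(unipOpPi c f)(0) = f(0)` (★ `coe_unipOpPi_apply`), and `λ′ ≠ 0` (★ `apply_zero_toRep_ne_zero`).
* **`twistedSection_kronLoc_nElem_smul_apply_eq_conj_unipOpPi_smul`** — the ONE-PARAMETER FAMILY `s′(n(b·τ)) Ψ = Γ⁻¹ (unipOpPi (b • c_τ) (Γ Ψ))` for all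
  `b ∈ L⁺_v` (`c_{bτ} = b • c_τ`, ★ `cOfFix_mover_conj_smul`) — conjunct 2 of the (OPW) junction, token for token, with `n b := n(b·τ)`, `c₀ := c_τ`.

Cell hodgecm-mathlib, line LD2 (soft road (π3) for the organ `LineThetaTypesComplementary₁` of crux hLiu418 = `stmt-HodgeConjecture-24832`), plate (BR-N)
of LD2-plan (g3) DEALS #24; consumer: the closer `Theorems/F0LD2OperatorWords.operatorWords_holds` (A-p19 (g31)).  HONEST LABEL: nothing of print is
asserted; HC_CM is proved only modulo the 7 printed citations (2 remaining: hLiu418 = stmt-HodgeConjecture-24832, h413 = stmt-HodgeConjecture-24833) until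
rung 0 closes; count-neutral.

## References
* [Kudla1994] S. S. Kudla, *Splitting metaplectic covers of dual reductive pairs*, Israel J. Math. 87 (1994), §3 Thm. 3.1.
* [MoeglinVignerasWaldspurger1987] C. Mœglin, M.-F. Vignéras, J.-L. Waldspurger, LNM 1291 (1987), Chap. 2 II.1 (A)–(B), II.6.
* [Rangarao1993] R. Ranga Rao, *On some explicit formulas in the theory of Weil representation*, Pacific J. Math. 157 (1993), Lemma 3.2 (3.8) p. 351, Thm. 3.5.
* [HarrisKudlaSweet1996] M. Harris, S. S. Kudla, W. J. Sweet, *Theta dichotomy for unitary groups*, J. AMS 9 (1996), §1 (1.15).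
-/

set_option autoImplicit false

noncomputable section

open scoped Matrix Kronecker
open NumberField IsDedekindDomain MeasureTheory MeasureTheory.Measure Matrix
open scoped NNReal
open Literature.RepresentationTheory.HeisenbergGroup Literature.RepresentationTheory.HeisenbergGroup.SymplecticMatrix
open Literature.NumberTheory.Automorphic Literature.NumberTheory.Automorphic.UnitaryGroup Literature.NumberTheory.Weil1964
open Literature.NumberTheory.Automorphic.UnitaryGroup.QuadraticCoordinates
open Literature.NumberTheory.GelbartRogawski1991.AdaptedBlocks
open Literature.NumberTheory.GaloisRepresentations Literature.NumberTheory.GaloisRepresentations.IsNonarchimedeanLocalField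
open Literature.RepresentationTheory.HarrisKudlaSweet1996
open Literature.GroupTheory Literature.LinearAlgebra.QuadraticForm

namespace Literature.NumberTheory.GelbartRogawski1991.UnitaryDualPair.LocalSplitting

/-! ## §1 Generic `E/F`: any implementer section at `ι_D(n(t))` is the conjugated `unipOpPi` up to a unit -/

section Generic

variable (F : Type) [Field F] [NumberField F] (E : Type) [Field E] [NumberField E] [Algebra F E]
  [Algebra.IsQuadraticExtension F E] (c : E ≃ₐ[F] E)
  {δ : E} (hcδ : c δ = -δ) (hδ : δ ≠ 0) {d : F} (hd : δ * δ = algebraMap F E d)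
  (v : HeightOneSpectrum (𝓞 F)) (n : ℕ) {T₀ : Matrix (Fin n) (Fin n) F} (hT₀ : T₀.IsSymm) (hT₀d : IsUnit T₀.det)
  {JD : Matrix (Fin (n + n)) (Fin (n + n)) E} (hJD : JD = (gramD F n T₀).map (algebraMap F E))

omit [Algebra.IsQuadraticExtension F E] in
/-- `nElem` depends on its parameter only (proof-irrelevance in the skewness witness). [cite: Kudla1994, §3] -/
theorem nElem_congr {t t' : Matrix (Fin n) (Fin n) (LocalRing E v)} (h : t = t')
    (ht : (t.map (conjLocal E c v))ᵀ * gramS F E v n T₀ + gramS F E v n T₀ * t = 0)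
    (ht' : (t'.map (conjLocal E c v))ᵀ * gramS F E v n T₀ + gramS F E v n T₀ * t' = 0) :
    nElem F E c v n hJD t ht = nElem F E c v n hJD t' ht' := by
  subst h
  rfl

include hT₀ hT₀d in
set_option maxHeartbeats 1600000 in -- the doubled datum's telescope (as ★ `LocalDoubledSiegelUnipotentMover`)
/-- **§1 `r(ι_D(n(t))) = γ • Γ⁻¹ ∘ unipOpPi (c ·) ∘ Γ`** for ANY implementer section `r` of a Schrödinger model with implementers unique up to scalars, any
mover `E′` (`E′ ℓ_Δ = ℓ_Y`) with implementer `Γ`, `c = cOfFix 𝕋 (E′ ι_D(n(t)) E′⁻¹)`: both sides implement `ι_D(n(t))` (★ `mover_conj_iotaD_nElem_eq_transportSp_low`,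
★ `implements_transportSp_low_unipOpPi`, ★ `exists_smul_eq_conj_of_implements_conj`). [cite: MoeglinVignerasWaldspurger1987, Chap. 2 II.1 (A), II.6]
[cite: Rangarao1993, Lemma 3.2 (3.8), p. 351] [cite: Kudla1994, §3 Thm. 3.1] -/
theorem exists_section_iotaD_nElem_apply_eq_smul_conj_unipOpPi
    (hU : ImplementerUniqueUpToScalar (localSchrodinger F (n + n) (gramD F n T₀) v))
    (r : ImplementerSection (localSchrodinger F (n + n) (gramD F n T₀) v))
    (E' : LocalSp F (n + n) (gramD F n T₀) v) (hE' : (deltaLagrangian F v n).map (toLin F v E') = lagrangianY F (n + n) v)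
    (Γ : SchwartzBruhat (Fin (n + n) → v.adicCompletion F) ≃ₗ[ℂ] SchwartzBruhat (Fin (n + n) → v.adicCompletion F))
    (hΓ : Implements (localSchrodinger F (n + n) (gramD F n T₀) v) (ofSymplectic _ E') Γ)
    (t : Matrix (Fin n) (Fin n) (LocalRing E v)) (ht : (t.map (conjLocal E c v))ᵀ * gramS F E v n T₀ + gramS F E v n T₀ * t = 0) :
    ∃ γ : ℂˣ, ∀ Φ : SchwartzBruhat (Fin (n + n) → v.adicCompletion F),
      r (iotaD F E c hcδ hδ hd v n hT₀ hJD (nElem F E c v n hJD t ht)) Φ =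
        (γ : ℂ) • Γ.symm (unipOpPi (isLocallyConstant_of_isContinuousNontrivial (isContinuousNontrivial_adeleAddCharAt F v))
          (Matrix.mulVecLin (cOfFix (localGram F (n + n) (gramD F n T₀) v)
            (E' * iotaD F E c hcδ hδ hd v n hT₀ hJD (nElem F E c v n hJD t ht) * E'⁻¹))) (Γ Φ)) := by
  have hM0 := implements_transportSp_low_unipOpPi (localGram F (n + n) (gramD F n T₀) v) (isUnit_det_localGram_gramD F v n hT₀d)
      (isLocallyConstant_of_isContinuousNontrivial (isContinuousNontrivial_adeleAddCharAt F v))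
      (continuous_toLinearMap₂'_left (localGram F (n + n) (gramD F n T₀) v))
      (cOfFix (localGram F (n + n) (gramD F n T₀) v) (E' * iotaD F E c hcδ hδ hd v n hT₀ hJD (nElem F E c v n hJD t ht) * E'⁻¹))
      (isSymm_cOfFix (localGram F (n + n) (gramD F n T₀) v) _
        (fun x => fst_mover_conj_apply F E c hcδ hδ hd v n hT₀ hJD _ t (adapt_matA_nElem F E c v n hJD t ht) E' hE' (x, 0)))
  have hB := mover_conj_iotaD_nElem_eq_transportSp_low F E c hcδ hδ hd v n hT₀ hT₀d hJD t ht E' hE'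
  rw [← hB] at hM0
  exact exists_smul_eq_conj_of_implements_conj (localSchrodinger F (n + n) (gramD F n T₀) v) hU (r.implements _) hΓ hM0

end Generic

/-! ## §2 CM: the twisted section at the Kronecker image of a rank-one Siegel unipotent IS the conjugated `unipOpPi` (no scalar) -/

section CM

variable (L : Type) [Field L] [NumberField L] [IsCMField L] (v : HeightOneSpectrum (𝓞 (maximalRealSubfield L)))
  [MeasurableSpace (v.adicCompletion (maximalRealSubfield L))] [BorelSpace (v.adicCompletion (maximalRealSubfield L))]
  (μ : Measure (v.adicCompletion (maximalRealSubfield L))) [μ.IsAddHaarMeasure]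
  {T : Matrix (Fin (1 + 1)) (Fin (1 + 1)) (maximalRealSubfield L)} (hTs : T.IsSymm) (hTd : IsUnit T.det)
  (χ : HeckeCharacter L) (hχ : IsSplittingChar L 1 χ)
  {JD₁ : Matrix (Fin (1 + 1)) (Fin (1 + 1)) L}
  (hJD₁ : JD₁ = (gramD (maximalRealSubfield L) 1 1).map (algebraMap (maximalRealSubfield L) L))

omit [MeasurableSpace (v.adicCompletion (maximalRealSubfield L))] [BorelSpace (v.adicCompletion (maximalRealSubfield L))] in
/-- **`ι(n₁(τ·1)) = n₂(τ·1)`**: the Kronecker embedding carries the rank-one Siegel unipotent with parameter `τ · 1₁` to the rank-two one with parameter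
`τ · 1₂` (★ `kronLoc_nElem` with `(τ·1)₀₀ = τ`). [cite: Kudla1994, §3] [cite: Weil1964, n° 32] -/
theorem kronLoc_nElem_smul_one (τ : LocalRing L v) (hτ : conjLocal L (IsCMField.complexConj L) v τ = -τ) :
    kronLoc (maximalRealSubfield L) L (IsCMField.complexConj L) v 2 (T := T) (J := T.map (algebraMap (maximalRealSubfield L) L))
        rfl rfl hJD₁
        (nElem (maximalRealSubfield L) L (IsCMField.complexConj L) v 1 hJD₁ (τ • 1)
          (skew_smul_one (maximalRealSubfield L) L (IsCMField.complexConj L) v 1 τ hτ)) =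
      nElem (maximalRealSubfield L) L (IsCMField.complexConj L) v 2 (T₀ := T) rfl (τ • 1)
        (skew_smul_one (maximalRealSubfield L) L (IsCMField.complexConj L) v 2 τ hτ) := by
  have h1 : (τ • (1 : Matrix (Fin 1) (Fin 1) (LocalRing L v))) 0 0 = τ := by
    rw [Matrix.smul_apply, Matrix.one_apply_eq, smul_eq_mul, mul_one]
  rw [kronLoc_nElem (maximalRealSubfield L) L (IsCMField.complexConj L) v 2 (T := T) rfl rfl hJD₁ (τ • 1)
    (skew_smul_one (maximalRealSubfield L) L (IsCMField.complexConj L) v 1 τ hτ)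
    (by rw [h1]; exact skew_smul_one (maximalRealSubfield L) L (IsCMField.complexConj L) v 2 τ hτ)]
  exact nElem_congr (maximalRealSubfield L) L (IsCMField.complexConj L) v 2 rfl (by rw [h1]) _ _

include hTd in
set_option synthInstance.maxHeartbeats 400000 in
set_option maxHeartbeats 4000000 in -- the doubled CM datum's telescope (as the (OPW) junction)
/-- **§2 `s′(n(τ)) = γ • Γ⁻¹ ∘ unipOpPi c_τ ∘ Γ` for some `γ ∈ ℂ`** (the twist `μ_v(det n(τ))⁻¹ = 1` by ★ `localMu_det_localPiEquiv_nElem`, Kudla's `β(n)⁻¹` and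
the unit of §1 folded into `γ`; `ω^𝔻(s^𝔻 g) = β(g)⁻¹ • r(ι_D g)` ★ `localOmega_apply`; `ι(n₁) = n₂` ★ `kronLoc_nElem`). [cite: Kudla1994, §3 Thm. 3.1]
[cite: MoeglinVignerasWaldspurger1987, Chap. 2 II.1 (A), II.6] -/
theorem exists_twistedSection_kronLoc_nElem_apply_eq_smul_conj_unipOpPi
    (E'' : LocalSp (maximalRealSubfield L) (2 + 2) (gramD (maximalRealSubfield L) 2 T) v)
    (hE'' : (deltaLagrangian (maximalRealSubfield L) v 2).map (toLin (maximalRealSubfield L) v E'') =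
      lagrangianY (maximalRealSubfield L) (2 + 2) v)
    (Γ : SchwartzBruhat (Fin (2 + 2) → v.adicCompletion (maximalRealSubfield L)) ≃ₗ[ℂ]
      SchwartzBruhat (Fin (2 + 2) → v.adicCompletion (maximalRealSubfield L)))
    (hΓ : Implements (localSchrodinger (maximalRealSubfield L) (2 + 2) (gramD (maximalRealSubfield L) 2 T) v) (ofSymplectic _ E'') Γ)
    (τ : LocalRing L v) (hτ : conjLocal L (IsCMField.complexConj L) v τ = -τ) :
    ∃ γ : ℂ, ∀ Ψ : SchwartzBruhat (Fin (2 + 2) → v.adicCompletion (maximalRealSubfield L)),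
      (((localMu L χ v (Matrix.GeneralLinearGroup.det ((localPiEquiv L (IsCMField.complexConj L) (1 + 1) JD₁ v
          (nElem (maximalRealSubfield L) L (IsCMField.complexConj L) v 1 hJD₁ (τ • 1)
            (skew_smul_one (maximalRealSubfield L) L (IsCMField.complexConj L) v 1 τ hτ))).1)))⁻¹ : ℂˣ) : ℂ) •
        MpPsi.toRep (localSchrodinger (maximalRealSubfield L) (2 + 2) (gramD (maximalRealSubfield L) 2 T) v)
          ((localSplittingDatumCM L v μ 2 hTs hTd rfl χ hχ).localSplitting
            (kronLoc (maximalRealSubfield L) L (IsCMField.complexConj L) v 2 (T := T) (J := T.map (algebraMap (maximalRealSubfield L) L))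
              rfl rfl hJD₁
              (nElem (maximalRealSubfield L) L (IsCMField.complexConj L) v 1 hJD₁ (τ • 1)
                (skew_smul_one (maximalRealSubfield L) L (IsCMField.complexConj L) v 1 τ hτ)))) Ψ =
        γ • Γ.symm (unipOpPi (isLocallyConstant_of_isContinuousNontrivial (isContinuousNontrivial_adeleAddCharAt (maximalRealSubfield L) v))
          (Matrix.mulVecLin (cOfFix (localGram (maximalRealSubfield L) (2 + 2) (gramD (maximalRealSubfield L) 2 T) v)
            (E'' * iotaD (maximalRealSubfield L) L (IsCMField.complexConj L) (complexConj_imagUnit L) (imagUnit_ne_zero L)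
              (imagUnit_mul_self L) v 2 hTs rfl
                (nElem (maximalRealSubfield L) L (IsCMField.complexConj L) v 2 (T₀ := T) rfl (τ • 1)
                  (skew_smul_one (maximalRealSubfield L) L (IsCMField.complexConj L) v 2 τ hτ)) * E''⁻¹))) (Γ Ψ)) := by
  set D := localSplittingDatumCM L v μ 2 hTs hTd rfl χ hχ with hD
  obtain ⟨γ₀, hγ₀⟩ := exists_section_iotaD_nElem_apply_eq_smul_conj_unipOpPi (maximalRealSubfield L) L (IsCMField.complexConj L)
    (complexConj_imagUnit L) (imagUnit_ne_zero L) (imagUnit_mul_self L) v 2 hTs hTd rfl D.hU D.r E'' hE'' Γ hΓ (τ • 1)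
    (skew_smul_one (maximalRealSubfield L) L (IsCMField.complexConj L) v 2 τ hτ)
  refine ⟨((((D.beta (nElem (maximalRealSubfield L) L (IsCMField.complexConj L) v 2 (T₀ := T) rfl (τ • 1)
      (skew_smul_one (maximalRealSubfield L) L (IsCMField.complexConj L) v 2 τ hτ)))⁻¹ : ℂˣ) : ℂ) * (γ₀ : ℂ)), fun Ψ => ?_⟩
  have hμ := localMu_det_localPiEquiv_nElem L v χ hJD₁ (τ • 1)
    (skew_smul_one (maximalRealSubfield L) L (IsCMField.complexConj L) v 1 τ hτ)
  have hω : MpPsi.toRep (localSchrodinger (maximalRealSubfield L) (2 + 2) (gramD (maximalRealSubfield L) 2 T) v)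
        (D.localSplitting (kronLoc (maximalRealSubfield L) L (IsCMField.complexConj L) v 2 (T := T)
          (J := T.map (algebraMap (maximalRealSubfield L) L)) rfl rfl hJD₁
            (nElem (maximalRealSubfield L) L (IsCMField.complexConj L) v 1 hJD₁ (τ • 1)
              (skew_smul_one (maximalRealSubfield L) L (IsCMField.complexConj L) v 1 τ hτ)))) Ψ =
      D.localOmega (nElem (maximalRealSubfield L) L (IsCMField.complexConj L) v 2 (T₀ := T) rfl (τ • 1)
        (skew_smul_one (maximalRealSubfield L) L (IsCMField.complexConj L) v 2 τ hτ)) Ψ := by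
    rw [kronLoc_nElem_smul_one L v hJD₁ τ hτ]; rfl
  rw [hμ, inv_one, Units.val_one, one_smul, hω, D.localOmega_apply, hγ₀ Ψ, Units.smul_def, smul_smul]

include hTd in
set_option synthInstance.maxHeartbeats 400000 in
set_option maxHeartbeats 4000000 in -- the doubled CM datum's telescope (as the (OPW) junction)
/-- **THE EXACT UNIPOTENT WORD `s′(n(τ)) Ψ = Γ⁻¹ (unipOpPi c_τ (Γ Ψ))` — NO SCALAR.**  The scalar of §2 is `1`: the `Δ`-functional `λ′ Φ := (Γ Φ)(0)` satisfies the
eigen-law `λ′(s′(p) Φ) = Δ_{P_Δ}(p) λ′(Φ)` on the Siegel parabolic (★ `apply_zero_toRep_twistedSection_kronLoc_eq_modularCharacter_mul` at the implementer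
`m₀ = (E″, Γ) ∈ S̃p_ψ`, `proj m₀ = E″` a mover), `Δ_{P_Δ}(n(τ)) = 1` (★ `modularCharacter_nElem_eq_one`), `(unipOpPi c f)(0) = ψ(0) f(0) = f(0)` (★ `coe_unipOpPi_apply`),
and `λ′ ≢ 0` (★ `apply_zero_toRep_ne_zero`), so `γ λ′(Φ₀) = λ′(Φ₀) ≠ 0`. [cite: Kudla1994, §3 Thm. 3.1] [cite: HarrisKudlaSweet1996, §1 (1.15)]
[cite: MoeglinVignerasWaldspurger1987, Chap. 2 II.1 (A)–(B), II.6] [cite: Rangarao1993, Thm. 3.5] -/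
theorem twistedSection_kronLoc_nElem_apply_eq_conj_unipOpPi
    (E'' : LocalSp (maximalRealSubfield L) (2 + 2) (gramD (maximalRealSubfield L) 2 T) v)
    (hE'' : (deltaLagrangian (maximalRealSubfield L) v 2).map (toLin (maximalRealSubfield L) v E'') =
      lagrangianY (maximalRealSubfield L) (2 + 2) v)
    (Γ : SchwartzBruhat (Fin (2 + 2) → v.adicCompletion (maximalRealSubfield L)) ≃ₗ[ℂ]
      SchwartzBruhat (Fin (2 + 2) → v.adicCompletion (maximalRealSubfield L)))
    (hΓ : Implements (localSchrodinger (maximalRealSubfield L) (2 + 2) (gramD (maximalRealSubfield L) 2 T) v) (ofSymplectic _ E'') Γ)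
    (τ : LocalRing L v) (hτ : conjLocal L (IsCMField.complexConj L) v τ = -τ)
    (Ψ : SchwartzBruhat (Fin (2 + 2) → v.adicCompletion (maximalRealSubfield L))) :
    (((localMu L χ v (Matrix.GeneralLinearGroup.det ((localPiEquiv L (IsCMField.complexConj L) (1 + 1) JD₁ v
        (nElem (maximalRealSubfield L) L (IsCMField.complexConj L) v 1 hJD₁ (τ • 1)
          (skew_smul_one (maximalRealSubfield L) L (IsCMField.complexConj L) v 1 τ hτ))).1)))⁻¹ : ℂˣ) : ℂ) •
      MpPsi.toRep (localSchrodinger (maximalRealSubfield L) (2 + 2) (gramD (maximalRealSubfield L) 2 T) v)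
        ((localSplittingDatumCM L v μ 2 hTs hTd rfl χ hχ).localSplitting
          (kronLoc (maximalRealSubfield L) L (IsCMField.complexConj L) v 2 (T := T) (J := T.map (algebraMap (maximalRealSubfield L) L))
            rfl rfl hJD₁
            (nElem (maximalRealSubfield L) L (IsCMField.complexConj L) v 1 hJD₁ (τ • 1)
              (skew_smul_one (maximalRealSubfield L) L (IsCMField.complexConj L) v 1 τ hτ)))) Ψ =
      Γ.symm (unipOpPi (isLocallyConstant_of_isContinuousNontrivial (isContinuousNontrivial_adeleAddCharAt (maximalRealSubfield L) v))
        (Matrix.mulVecLin (cOfFix (localGram (maximalRealSubfield L) (2 + 2) (gramD (maximalRealSubfield L) 2 T) v)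
          (E'' * iotaD (maximalRealSubfield L) L (IsCMField.complexConj L) (complexConj_imagUnit L) (imagUnit_ne_zero L)
            (imagUnit_mul_self L) v 2 hTs rfl
              (nElem (maximalRealSubfield L) L (IsCMField.complexConj L) v 2 (T₀ := T) rfl (τ • 1)
                (skew_smul_one (maximalRealSubfield L) L (IsCMField.complexConj L) v 2 τ hτ)) * E''⁻¹))) (Γ Ψ)) := by
  obtain ⟨γ, hγ⟩ := exists_twistedSection_kronLoc_nElem_apply_eq_smul_conj_unipOpPi L v μ hTs hTd χ hχ hJD₁ E'' hE'' Γ hΓ τ hτ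
  -- the value at `0` of `unipOpPi c f` is `f 0`
  have hU0 : ∀ f : SchwartzBruhat (Fin (2 + 2) → v.adicCompletion (maximalRealSubfield L)),
      ((unipOpPi (isLocallyConstant_of_isContinuousNontrivial (isContinuousNontrivial_adeleAddCharAt (maximalRealSubfield L) v))
        (Matrix.mulVecLin (cOfFix (localGram (maximalRealSubfield L) (2 + 2) (gramD (maximalRealSubfield L) 2 T) v)
          (E'' * iotaD (maximalRealSubfield L) L (IsCMField.complexConj L) (complexConj_imagUnit L) (imagUnit_ne_zero L)
            (imagUnit_mul_self L) v 2 hTs rfl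
              (nElem (maximalRealSubfield L) L (IsCMField.complexConj L) v 2 (T₀ := T) rfl (τ • 1)
                (skew_smul_one (maximalRealSubfield L) L (IsCMField.complexConj L) v 2 τ hτ)) * E''⁻¹))) f :
        SchwartzBruhat (Fin (2 + 2) → v.adicCompletion (maximalRealSubfield L))) : (Fin (2 + 2) → v.adicCompletion (maximalRealSubfield L)) → ℂ) 0 =
      (f : (Fin (2 + 2) → v.adicCompletion (maximalRealSubfield L)) → ℂ) 0 := by
    intro f
    rw [coe_unipOpPi_apply, halfForm, map_zero, LinearMap.zero_apply, mul_zero, neg_zero, AddChar.map_zero_eq_one, Circle.coe_one, one_mul]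
  -- the `Δ`-functional `Φ ↦ (Γ Φ)(0)` is an eigenfunctional of the twisted section with eigencharacter `Δ_{P_Δ} = 1` at `n(τ)`
  have h1s : (1 : Matrix (Fin 1) (Fin 1) (maximalRealSubfield L)).IsSymm := Matrix.isSymm_one
  have h1d : IsUnit (1 : Matrix (Fin 1) (Fin 1) (maximalRealSubfield L)).det := by
    rw [Matrix.det_one]; exact isUnit_one
  let P : Subgroup (localPi L (IsCMField.complexConj L) (1 + 1) JD₁ v) :=
    { carrier := {h | IsSiegelDelta (maximalRealSubfield L) L (IsCMField.complexConj L) (complexConj_imagUnit L) (imagUnit_ne_zero L)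
        (imagUnit_mul_self L) v 1 h1s hJD₁ h}
      mul_mem' := fun ha hb => ha.mul hb
      one_mem' := isSiegelDelta_one (maximalRealSubfield L) L (IsCMField.complexConj L) (complexConj_imagUnit L) (imagUnit_ne_zero L)
        (imagUnit_mul_self L) v 1 h1s hJD₁
      inv_mem' := fun ha => ha.inv }
  have hP : ∀ h, h ∈ P ↔ IsSiegelDelta (maximalRealSubfield L) L (IsCMField.complexConj L) (complexConj_imagUnit L) (imagUnit_ne_zero L)
      (imagUnit_mul_self L) v 1 h1s hJD₁ h := fun _ => Iff.rfl
  haveI := locallyCompactSpace_of_isSiegelDelta (maximalRealSubfield L) L (IsCMField.complexConj L) (complexConj_imagUnit L)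
    (imagUnit_ne_zero L) (imagUnit_mul_self L) v 1 h1s hJD₁ P hP
  let m₀ : LocalMp (maximalRealSubfield L) (2 + 2) (gramD (maximalRealSubfield L) 2 T) v := ⟨(E'', Γ), hΓ⟩
  have hm₀ : (deltaLagrangian (maximalRealSubfield L) v 2).map (toLin (maximalRealSubfield L) v (MpPsi.proj _ m₀)) =
      lagrangianY (maximalRealSubfield L) (2 + 2) v := hE''
  let p : ↥P := ⟨nElem (maximalRealSubfield L) L (IsCMField.complexConj L) v 1 hJD₁ (τ • 1)
      (skew_smul_one (maximalRealSubfield L) L (IsCMField.complexConj L) v 1 τ hτ), (hP _).2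
    (isSiegelDelta_nElem (maximalRealSubfield L) L (IsCMField.complexConj L) (complexConj_imagUnit L) (imagUnit_ne_zero L)
      (imagUnit_mul_self L) v 1 h1s hJD₁ (τ • 1) (skew_smul_one (maximalRealSubfield L) L (IsCMField.complexConj L) v 1 τ hτ))⟩
  have hmod : modularCharacter p = 1 :=
    modularCharacter_nElem_eq_one L v h1s h1d hJD₁ P hP (τ • 1)
      (skew_smul_one (maximalRealSubfield L) L (IsCMField.complexConj L) v 1 τ hτ)
  -- `γ · (Γ Φ)(0) = (Γ Φ)(0)` for every `Φ`
  have hγ1 : ∀ Φ : SchwartzBruhat (Fin (2 + 2) → v.adicCompletion (maximalRealSubfield L)),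
      γ * ((Γ Φ : SchwartzBruhat (Fin (2 + 2) → v.adicCompletion (maximalRealSubfield L))) :
        (Fin (2 + 2) → v.adicCompletion (maximalRealSubfield L)) → ℂ) 0 =
      ((Γ Φ : SchwartzBruhat (Fin (2 + 2) → v.adicCompletion (maximalRealSubfield L))) :
        (Fin (2 + 2) → v.adicCompletion (maximalRealSubfield L)) → ℂ) 0 := by
    intro Φ
    have heig := apply_zero_toRep_twistedSection_kronLoc_eq_modularCharacter_mul L v μ χ hχ hTs hTd hJD₁ h1s P hP m₀ hm₀ p Φ
    rw [hmod, NNReal.coe_one, Complex.ofReal_one, one_mul, MpPsi.toRep_apply, MpPsi.toRep_apply] at heig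
    change ((Γ ((((localMu L χ v (Matrix.GeneralLinearGroup.det ((localPiEquiv L (IsCMField.complexConj L) (1 + 1) JD₁ v
        (nElem (maximalRealSubfield L) L (IsCMField.complexConj L) v 1 hJD₁ (τ • 1)
          (skew_smul_one (maximalRealSubfield L) L (IsCMField.complexConj L) v 1 τ hτ))).1)))⁻¹ : ℂˣ) : ℂ) •
      MpPsi.toRep (localSchrodinger (maximalRealSubfield L) (2 + 2) (gramD (maximalRealSubfield L) 2 T) v)
        ((localSplittingDatumCM L v μ 2 hTs hTd rfl χ hχ).localSplitting
          (kronLoc (maximalRealSubfield L) L (IsCMField.complexConj L) v 2 (T := T) (J := T.map (algebraMap (maximalRealSubfield L) L))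
            rfl rfl hJD₁
            (nElem (maximalRealSubfield L) L (IsCMField.complexConj L) v 1 hJD₁ (τ • 1)
              (skew_smul_one (maximalRealSubfield L) L (IsCMField.complexConj L) v 1 τ hτ)))) Φ) :
        SchwartzBruhat (Fin (2 + 2) → v.adicCompletion (maximalRealSubfield L))) : (Fin (2 + 2) → v.adicCompletion (maximalRealSubfield L)) → ℂ) 0 =
      ((Γ Φ : SchwartzBruhat (Fin (2 + 2) → v.adicCompletion (maximalRealSubfield L))) :
        (Fin (2 + 2) → v.adicCompletion (maximalRealSubfield L)) → ℂ) 0 at heig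
    rw [hγ Φ, map_smul, LinearEquiv.apply_symm_apply, Submodule.coe_smul, Pi.smul_apply, smul_eq_mul, hU0] at heig
    exact heig
  -- a test function with `(Γ Φ)(0) ≠ 0` forces `γ = 1`
  obtain ⟨Φ₀, hΦ₀⟩ := apply_zero_toRep_ne_zero (maximalRealSubfield L) (2 + 2) (gramD (maximalRealSubfield L) 2 T) v m₀
  rw [MpPsi.toRep_apply] at hΦ₀
  have hγ' : γ = 1 := (mul_eq_right₀ hΦ₀).1 (hγ1 Φ₀)
  rw [hγ Ψ, hγ', one_smul]

omit [MeasurableSpace (v.adicCompletion (maximalRealSubfield L))] [BorelSpace (v.adicCompletion (maximalRealSubfield L))] in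
/-- `L⁺_v`-multiples of a skew element of `L ⊗ L⁺_v` are skew (`c̄` is `L⁺_v`-linear, ★ `conjLocal_smul`) — the skewness witness of the one-parameter
family `n(b·τ)`. [cite: Kudla1994, §3] -/
theorem skew_smul (b : v.adicCompletion (maximalRealSubfield L)) (τ : LocalRing L v)
    (hτ : conjLocal L (IsCMField.complexConj L) v τ = -τ) :
    conjLocal L (IsCMField.complexConj L) v (b • τ) = -(b • τ) := by
  rw [conjLocal_smul (IsCMField.complexConj L) v b τ, hτ, smul_neg]

include hTd in
set_option synthInstance.maxHeartbeats 400000 in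
set_option maxHeartbeats 4000000 in -- the doubled CM datum's telescope (as the (OPW) junction)
/-- **THE ONE-PARAMETER UNIPOTENT WORD `s′(n(b·τ)) Ψ = Γ⁻¹ (unipOpPi (b • c_τ) (Γ Ψ))` for all `b ∈ L⁺_v`** — conjunct 2 of the (OPW) junction
★ `zVan_of_operatorWords` with `n b := n(b·τ)`, `c₀ := c_τ` (the exact word at `b·τ`, and `c_{bτ} = b • c_τ` by ★ `cOfFix_mover_conj_smul`, ★ `Matrix.smul_mulVec`).
[cite: Kudla1994, §3 Thm. 3.1] [cite: Rangarao1993, Lemma 3.2 (3.8), p. 351; Thm. 3.5] [cite: MoeglinVignerasWaldspurger1987, Chap. 2 II.6] -/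
theorem twistedSection_kronLoc_nElem_smul_apply_eq_conj_unipOpPi_smul
    (E'' : LocalSp (maximalRealSubfield L) (2 + 2) (gramD (maximalRealSubfield L) 2 T) v)
    (hE'' : (deltaLagrangian (maximalRealSubfield L) v 2).map (toLin (maximalRealSubfield L) v E'') =
      lagrangianY (maximalRealSubfield L) (2 + 2) v)
    (Γ : SchwartzBruhat (Fin (2 + 2) → v.adicCompletion (maximalRealSubfield L)) ≃ₗ[ℂ]
      SchwartzBruhat (Fin (2 + 2) → v.adicCompletion (maximalRealSubfield L)))
    (hΓ : Implements (localSchrodinger (maximalRealSubfield L) (2 + 2) (gramD (maximalRealSubfield L) 2 T) v) (ofSymplectic _ E'') Γ)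
    (τ : LocalRing L v) (hτ : conjLocal L (IsCMField.complexConj L) v τ = -τ)
    (b : v.adicCompletion (maximalRealSubfield L))
    (Ψ : SchwartzBruhat (Fin (2 + 2) → v.adicCompletion (maximalRealSubfield L))) :
    (((localMu L χ v (Matrix.GeneralLinearGroup.det ((localPiEquiv L (IsCMField.complexConj L) (1 + 1) JD₁ v
        (nElem (maximalRealSubfield L) L (IsCMField.complexConj L) v 1 hJD₁ ((b • τ) • 1)
          (skew_smul_one (maximalRealSubfield L) L (IsCMField.complexConj L) v 1 (b • τ) (skew_smul L v b τ hτ)))).1)))⁻¹ : ℂˣ) : ℂ) •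
      MpPsi.toRep (localSchrodinger (maximalRealSubfield L) (2 + 2) (gramD (maximalRealSubfield L) 2 T) v)
        ((localSplittingDatumCM L v μ 2 hTs hTd rfl χ hχ).localSplitting
          (kronLoc (maximalRealSubfield L) L (IsCMField.complexConj L) v 2 (T := T) (J := T.map (algebraMap (maximalRealSubfield L) L))
            rfl rfl hJD₁
            (nElem (maximalRealSubfield L) L (IsCMField.complexConj L) v 1 hJD₁ ((b • τ) • 1)
              (skew_smul_one (maximalRealSubfield L) L (IsCMField.complexConj L) v 1 (b • τ) (skew_smul L v b τ hτ))))) Ψ =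
      Γ.symm (unipOpPi (isLocallyConstant_of_isContinuousNontrivial (isContinuousNontrivial_adeleAddCharAt (maximalRealSubfield L) v))
        (b • Matrix.mulVecLin (cOfFix (localGram (maximalRealSubfield L) (2 + 2) (gramD (maximalRealSubfield L) 2 T) v)
          (E'' * iotaD (maximalRealSubfield L) L (IsCMField.complexConj L) (complexConj_imagUnit L) (imagUnit_ne_zero L)
            (imagUnit_mul_self L) v 2 hTs rfl
              (nElem (maximalRealSubfield L) L (IsCMField.complexConj L) v 2 (T₀ := T) rfl (τ • 1)
                (skew_smul_one (maximalRealSubfield L) L (IsCMField.complexConj L) v 2 τ hτ)) * E''⁻¹))) (Γ Ψ)) := by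
  have hc := cOfFix_mover_conj_smul (maximalRealSubfield L) L (IsCMField.complexConj L) (complexConj_imagUnit L) (imagUnit_ne_zero L)
    (imagUnit_mul_self L) v 2 hTs (rfl : (gramD (maximalRealSubfield L) 2 T).map (algebraMap (maximalRealSubfield L) L) = _)
    (nElem (maximalRealSubfield L) L (IsCMField.complexConj L) v 2 (T₀ := T) rfl (τ • 1)
      (skew_smul_one (maximalRealSubfield L) L (IsCMField.complexConj L) v 2 τ hτ))
    (nElem (maximalRealSubfield L) L (IsCMField.complexConj L) v 2 (T₀ := T) rfl ((b • τ) • 1)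
      (skew_smul_one (maximalRealSubfield L) L (IsCMField.complexConj L) v 2 (b • τ) (skew_smul L v b τ hτ)))
    (τ • 1) b (adapt_matA_nElem (maximalRealSubfield L) L (IsCMField.complexConj L) v 2 rfl _ _)
    (by rw [adapt_matA_nElem, smul_assoc]) E''
  have hlin : Matrix.mulVecLin (b • cOfFix (localGram (maximalRealSubfield L) (2 + 2) (gramD (maximalRealSubfield L) 2 T) v)
        (E'' * iotaD (maximalRealSubfield L) L (IsCMField.complexConj L) (complexConj_imagUnit L) (imagUnit_ne_zero L)
          (imagUnit_mul_self L) v 2 hTs rfl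
            (nElem (maximalRealSubfield L) L (IsCMField.complexConj L) v 2 (T₀ := T) rfl (τ • 1)
              (skew_smul_one (maximalRealSubfield L) L (IsCMField.complexConj L) v 2 τ hτ)) * E''⁻¹)) =
      b • Matrix.mulVecLin (cOfFix (localGram (maximalRealSubfield L) (2 + 2) (gramD (maximalRealSubfield L) 2 T) v)
        (E'' * iotaD (maximalRealSubfield L) L (IsCMField.complexConj L) (complexConj_imagUnit L) (imagUnit_ne_zero L)
          (imagUnit_mul_self L) v 2 hTs rfl
            (nElem (maximalRealSubfield L) L (IsCMField.complexConj L) v 2 (T₀ := T) rfl (τ • 1)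
              (skew_smul_one (maximalRealSubfield L) L (IsCMField.complexConj L) v 2 τ hτ)) * E''⁻¹)) :=
    LinearMap.ext fun x => Matrix.smul_mulVec b _ x
  rw [twistedSection_kronLoc_nElem_apply_eq_conj_unipOpPi L v μ hTs hTd χ hχ hJD₁ E'' hE'' Γ hΓ (b • τ) (skew_smul L v b τ hτ) Ψ, hc, hlin]

end CM

end Literature.NumberTheory.GelbartRogawski1991.UnitaryDualPair.LocalSplitting

end
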